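/-
Copyright (c) 2026. All rights reserved.
Released under Apache 2.0 license as described in the file LICENSE.
Authors: HodgeCM publication cell (pub-hodgecm), GR lane, seat GR-2 (`pub-hodgecm-own-hyp34`).
-/
import Literature.NumberTheory.Weil1964.ArchUnitaryWeilHalf3
import Literature.NumberTheory.Weil1964.ArchMetaplecticVacuumCentral
import HarnessLib

/-!
# The three-block archimedean Weil section at a SIGN ELEMENT of the split real places is the sign Levi operator

Sequel of `ArchUnitaryWeilHalf3` (the section `archWeilSection3 x₂ x₃ : U(J)(F ⊗ ℝ) →* Mp^𝓢(ℝ^{FrameIdx})` of an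
arbitrary quadratic extension `E/F`) and `ArchMetaplecticVacuumCentral`.  A SIGN ELEMENT `g ∈ U(J)(F ⊗ ℝ)` of the split
real places is one whose components at the complex places of `E` are `1` and whose component at the chosen real place
`w₂(v)` over each split real place `v` of `F` is a sign diagonal matrix `diag(ε_v)`, `ε_{v,j} = ±1` (so it is
`F_v`-rational there: `g_{c w₂(v)} = diag(ε_v)` as well).  For such `g`:

* §1 the blocks: the type-(i) block and the complex block of the section are `1`, and the type-(ii) block is the sign
  Levi operator `leviGL (diag ε)` ON THE NOSE — the conjugating lift `x₂` of the framed split Cayley elements drops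
  out, because the Cayley elements act coordinatewise (`rsCayley_mul_proj_leviGL_of_eq_diagonal_sign`) and a sign
  Levi operator commutes with every lift of its centraliser (`MpS.conj_leviGL_eq_of_eq_diagonal_sign`);
* §2 **`archWeilSection3_eq_leviGL_of_sign`**: `archWeilSection3 x₂ x₃ g = leviGL ã` for the sign diagonal `ã` of
  `ℝ^{FrameIdx}` (`1` at the type-(i) and complex coordinates, `ε_{v,j}` at the type-(ii) coordinates) — two elements
  of `Mp^𝓢` over the same point with the same (non-zero) vacuum coefficient are equal (`MpS.eq_of_proj_eq_of_vac_eq`);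
* §3 consequences: `(archWeilSection3 x₂ x₃ g · f)(0) = f(0)` (origin value `+1`, modulus `1`), and
  `z · archWeilSection3 x₂ x₃ g · z⁻¹ = archWeilSection3 x₂ x₃ g` for every `z ∈ Mp^𝓢` over the centraliser of `m(ã)`.

This is the section-side input of the parabolic prescription of [GelbartRogawski1991, Prop. 3.1.1] at the real places
of `F` split in `E`: on the `F_v`-rational sign elements of the Siegel parabolic the origin value of the archimedean
half is `+1`.  Topic `NumberTheory/Weil1964`; KERNEL ONLY: theorems; no definition, no `def … : Prop`, no `sorry`.
Written for the stage-1 cell `pub-hodgecm` (GR lane); nothing here is a claim of the manuscripts adjudicated by that cell.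

## References
* [GelbartRogawski1991] S. Gelbart, J. Rogawski, Invent. math. 105 (1991), §3.1 p. 454–455, Prop. 3.1.1.
* [Kudla1994] S. S. Kudla, Israel J. Math. 87 (1994), §3.
* [Folland1989] G. B. Folland, *Harmonic Analysis in Phase Space*, Princeton UP 1989, §4.2 (4.23)–(4.24), (4.36).
* [MoeglinVignerasWaldspurger1987] C. Mœglin, M.-F. Vignéras, J.-L. Waldspurger, LNM 1291 (1987), Chap. 2 II.2, III.1.
-/

set_option autoImplicit false

noncomputable section

open scoped Matrix Real Classical ComplexConjugate
open Complex NumberField NumberField.InfinitePlace NumberField.mixedEmbedding IsDedekindDomain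
open Literature.NumberTheory.Automorphic Literature.NumberTheory.Automorphic.UnitaryGroup
open Literature.RepresentationTheory.HeisenbergGroup Literature.Analysis.SegalBargmann
open Literature.RepresentationTheory.HeisenbergGroup.SymplecticMatrix
open Literature.RepresentationTheory.KonnoKonno2007 Literature.RepresentationTheory.KonnoKonno2007.RealDualPair

namespace Literature.NumberTheory.Weil1964

open MpS UnitaryWeil

local notation "PV" σ => (σ → ℝ) × (σ → ℝ)
local notation "SpR" σ => symplecticGroup (polar (dotPairing σ))

/-! ## §0 Two generic tools on `Mp^𝓢` -/

section Tools

variable {σ : Type*} [Fintype σ] [DecidableEq σ]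

/-- an element fixing the vacuum vector has vacuum coefficient `1`. [cite: Folland1989, §4.2 (4.36)] -/
theorem MpS.vac_eq_one_of_apply_hermitePi_zero {x : MpS σ} (hx : x.1.2 (hermitePi (0 : σ →₀ ℕ)) = hermitePi 0) :
    MpS.vac x = 1 := by
  rw [← MpS.vac_one (σ := σ), MpS.vac_apply, MpS.vac_apply, hx]
  rfl

/-- the origin value of a sign Levi operator: `(leviGL a f)(0) = f(0)` for `a = diag(ε)`, `ε_i = ±1`.
[cite: Folland1989, §4.2 (4.24)] -/
theorem MpS.leviGL_apply_zero_of_eq_diagonal_sign (ε : σ → ℝ) (hε : ∀ i, ε i = 1 ∨ ε i = -1) (a : GL σ ℝ)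
    (ha : (a : Matrix σ σ ℝ) = Matrix.diagonal ε) (f : SchwartzMap (σ → ℝ) ℂ) : (MpS.leviGL a).1.2 f 0 = f 0 := by
  rw [leviGL_apply_snd, leviS_apply, map_zero, leviFactor,
    show ((glEquiv a : (σ → ℝ) ≃ₗ[ℝ] (σ → ℝ)) : (σ → ℝ) →ₗ[ℝ] (σ → ℝ)) = Matrix.toLin' (Matrix.diagonal ε) from
      LinearMap.ext fun x => by rw [Matrix.toLin'_apply, ← ha]; exact glEquiv_apply _ x,
    LinearMap.det_toLin', abs_det_diagonal_sign ε hε, Real.one_rpow, Complex.ofReal_one, one_mul]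

end Tools

/-! ## §1 The framed split Cayley element commutes with the sign Levis -/

section Cayley

variable {ι : Type} [Fintype ι] [DecidableEq ι] (t : ι → ℝ) (ht : ∀ j, t j ≠ 0) {s : ℝ} (hs : s ≠ 0)
  (ε : ι → ℝ) (hε : ∀ i, ε i = 1 ∨ ε i = -1) (a : GL ι ℝ) (ha : (a : Matrix ι ι ℝ) = Matrix.diagonal ε)

include hε ha in
/-- **`rsCayley` commutes with the sign Levis**: it acts coordinate by coordinate (`(p_j, q_j) ↦ (linear in p_j, q_j)`),
so it commutes with `(p, q) ↦ (ε p, ε q)`. [cite: MoeglinVignerasWaldspurger1987, Chap. 2 III.1; Folland1989, §4.2 (4.24)] -/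
theorem rsCayley_mul_proj_leviGL_of_eq_diagonal_sign :
    rsCayley t ht hs * MpS.proj (MpS.leviGL a) = MpS.proj (MpS.leviGL a) * rsCayley t ht hs := by
  apply Subtype.ext
  apply LinearEquiv.ext
  intro pq
  rw [Subgroup.coe_mul, Subgroup.coe_mul, LinearEquiv.mul_apply, LinearEquiv.mul_apply,
    MpS.coe_proj_leviGL_apply_of_eq_diagonal_sign ε hε a ha, MpS.coe_proj_leviGL_apply_of_eq_diagonal_sign ε hε a ha,
    rsCayley, coe_rsRealify_apply, coe_rsRealify_apply, follandScaleEquiv_one_symm_apply, follandScaleEquiv_one_symm_apply]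
  simp only [IsQuadraticCoordinates.coe_splitCayley, IsQuadraticCoordinates.splitCayleyEquiv_apply, follandScale_apply]
  refine Prod.ext (funext fun j => ?_) (funext fun j => ?_) <;>
    simp only [Matrix.mulVec_diagonal, Pi.add_apply, Pi.smul_apply, Pi.sub_apply, smul_eq_mul] <;> ring

end Cayley

/-! ## §2 The three-block section at a sign element -/

section Sign

variable {F : Type} [Field F] [NumberField F] (E : Type) [Field E] [NumberField E] [Algebra F E]
  (c : E ≃ₐ[F] E) (N : ℕ) (hc : c ≠ 1) (hcc : c * c = 1)
  (p : {v : InfinitePlace F // v.IsReal} → Prop)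
  (wOf₁ : {v : {v : InfinitePlace F // v.IsReal} // p v} → {w : InfinitePlace E // w.IsComplex})
  (hw₁ : ∀ k, c • (wOf₁ k).1 = (wOf₁ k).1) (hover₁ : ∀ k, (wOf₁ k).1.comap (algebraMap F E) = k.1.1)
  (wOf₂ : {v : {v : InfinitePlace F // v.IsReal} // ¬ p v} → {w : InfinitePlace E // w.IsReal})
  (wOf : {v : InfinitePlace F // v.IsComplex} → {w : InfinitePlace E // w.IsComplex})
  (t₀ : Fin N → F) (ht0 : ∀ j, t₀ j ≠ 0) {T : Matrix (Fin N) (Fin N) F} (hTd : T = Matrix.diagonal t₀)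
  {J : Matrix (Fin N) (Fin N) E} (hJ : J = T.map (algebraMap F E)) {δ : E} (hcδ : c δ = -δ) (hδ : δ ≠ 0)
  (x₂ : MpS (Fin N × {v : {v : InfinitePlace F // v.IsReal} // ¬ p v}))
  (hx₂ : MpS.proj x₂ = placeSp fun k => (rsCayley3 E N p wOf₂ t₀ ht0 hδ k)⁻¹)
  (x₃ : MpS ((Fin N ⊕ Fin N) × {v : InfinitePlace F // v.IsComplex}))
  (g : UnitaryGroup.arch F E c N J)
  (hC : ∀ w : {w : InfinitePlace E // w.IsComplex},
    (((g : GL (Fin N) (mixedSpace E)) : Matrix (Fin N) (Fin N) (mixedSpace E))).map (evalC E w) = 1)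
  (εR : {v : {v : InfinitePlace F // v.IsReal} // ¬ p v} → Fin N → ℝ) (hεR : ∀ k j, εR k j = 1 ∨ εR k j = -1)
  (hR : ∀ k : {v : {v : InfinitePlace F // v.IsReal} // ¬ p v},
    (((g : GL (Fin N) (mixedSpace E)) : Matrix (Fin N) (Fin N) (mixedSpace E))).map (evalR E (wOf₂ k)) =
      Matrix.diagonal (εR k))

include hC in
omit [NumberField F] [NumberField E] in
/-- the components at the complex places `w` are `1`: `archAt w g = 1`. [cite: GelbartRogawski1991, §3.1 p. 454] -/
theorem coe_archAt_eq_one_of_sign (w : {w : InfinitePlace E // w.IsComplex}) (hw : c • w.1 = w.1) :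
    (((archAt F E c N J w hw hc g : archLocal E N J w) : GL (Fin N) ℂ) : Matrix (Fin N) (Fin N) ℂ) = 1 := by
  rw [coe_archAt]
  exact hC w

include hC in
/-- **the type-(i) block is `1`** at a sign element of the split places. [cite: GelbartRogawski1991, §3.1 p. 454] -/
theorem archWeilSectionSub_eq_one_of_sign :
    archWeilSectionSub E c N hc (fun k => k.1) wOf₁ hw₁ hover₁ t₀ ht0 hTd hJ hcδ hδ g = 1 := by
  have h1 : archUFormPiSub E c N hc (fun k => k.1) wOf₁ hw₁ hover₁ t₀ ht0 hTd hJ hcδ hδ g = 1 := by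
    funext k
    rw [archUFormPiSub_apply, Pi.one_apply]
    have hmat : (((archUFormAt E c N hc k.1 (wOf₁ k) (hw₁ k) (hover₁ k) t₀ (hJ_diagonal E N t₀ hTd hJ)
        (signSplit (signVecAt k.1 (wOf₁ k) t₀ δ)) (sqrtAbs_signVecAt_ne_zero hc (hw₁ k) hcδ hδ ht0)
        (deltaImAt_ne_zero hc (hw₁ k) hcδ hδ) (ht_signVecAt hc (hw₁ k) hcδ hδ ht0)
        (UnitaryGroup.archToAdelic F E c N J g) :
          UForm (PosIdx (signVecAt k.1 (wOf₁ k) t₀ δ)) (NegIdx (signVecAt k.1 (wOf₁ k) t₀ δ))) :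
          GL (PosIdx (signVecAt k.1 (wOf₁ k) t₀ δ) ⊕ NegIdx (signVecAt k.1 (wOf₁ k) t₀ δ)) ℂ) :
          Matrix (PosIdx (signVecAt k.1 (wOf₁ k) t₀ δ) ⊕ NegIdx (signVecAt k.1 (wOf₁ k) t₀ δ))
            (PosIdx (signVecAt k.1 (wOf₁ k) t₀ δ) ⊕ NegIdx (signVecAt k.1 (wOf₁ k) t₀ δ)) ℂ) = 1 := by
      rw [coe_archUFormAt, archPart_archToAdelic, coe_archAt_eq_one_of_sign E c N hc g hC (wOf₁ k) (hw₁ k)]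
      ext i j
      rw [Matrix.reindex_apply, Matrix.submatrix_apply, scaleConj_apply, Matrix.one_apply, Matrix.one_apply]
      by_cases hij : i = j
      · subst hij
        rw [if_pos rfl, if_pos rfl, mul_one,
          mul_inv_cancel₀ (Complex.ofReal_ne_zero.2 (sqrtAbs_signVecAt_ne_zero hc (hw₁ k) hcδ hδ ht0 _))]
      · rw [if_neg hij, if_neg (fun h => hij ((signSplit (signVecAt k.1 (wOf₁ k) t₀ δ)).symm.injective h)), mul_zero,
          zero_mul]
    exact Subtype.ext (Units.ext hmat)
  simp only [archWeilSectionSub_apply, h1, map_one]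

include hC in
omit [NumberField E] in
/-- **the complex block is `1`** at a sign element of the split places. [cite: GelbartRogawski1991, §3.1 p. 454] -/
theorem cxPlacesSection_eq_one_of_sign : cxPlacesSection F E c hcc N T hJ hδ wOf x₃ g = 1 := by
  have h1 : cxLeviFamily F E c hcc N T hJ hδ wOf g = 1 := by
    funext v
    rw [cxLeviFamily_apply, Pi.one_apply]
    have h2 : (isQuadraticCoordinates_splitPair (cxDelta F E wOf δ v) (cxDelta_ne_zero F E hδ wOf v)).plusGL rfl (Fin N)
        (archAtComplexSplit F E c N hcc (wOf v) T hJ g : unitaryGroupOfForm _ _) = 1 :=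
      Units.ext ((coe_plusGL_archAtComplexSplit_eq F E c N hcc (wOf v) T hJ hδ g).trans (hC (wOf v)))
    rw [h2, map_one]
  rw [cxPlacesSection, placeLeviSection_apply, h1]
  simp only [map_one, MpS.leviGL_one, mul_one, mul_inv_cancel]

include hR in
omit [NumberField E] in
/-- the matrix of the type-(ii) Levi family at a sign element is the sign diagonal `diag (j,k) ↦ ε_{k,j}`.
[cite: Folland1989, §4.2 (4.24)] -/
theorem coe_placeDiag_rsLeviFamily_of_sign :
    ((GL.placeDiag (Fin N) {v : {v : InfinitePlace F // v.IsReal} // ¬ p v} (rsLeviFamily F E c hcc N T hJ hδ wOf₂ g) :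
        GL (Fin N × {v : {v : InfinitePlace F // v.IsReal} // ¬ p v}) ℝ) :
        Matrix (Fin N × {v : {v : InfinitePlace F // v.IsReal} // ¬ p v}) (Fin N × {v : {v : InfinitePlace F // v.IsReal} // ¬ p v}) ℝ) =
      Matrix.diagonal fun jk : Fin N × {v : {v : InfinitePlace F // v.IsReal} // ¬ p v} => εR jk.2 jk.1 := by
  rw [GL.coe_placeDiag]
  have h : (fun k => ((rsLeviFamily F E c hcc N T hJ hδ wOf₂ g k : GL (Fin N) ℝ) : Matrix (Fin N) (Fin N) ℝ)) =
      fun k => Matrix.diagonal (εR k) := funext fun k => by rw [coe_rsLeviFamily, hR k]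
  rw [h, Matrix.blockDiagonal_diagonal]

include hR hεR hx₂ in
omit [NumberField E] in
/-- **the type-(ii) block IS the sign Levi operator** `leviGL (diag ε)` — the Cayley conjugation drops out.
[cite: Folland1989, §4.2 (4.23)–(4.24); MoeglinVignerasWaldspurger1987, Chap. 2 III.1] -/
theorem rsPlacesSection_eq_leviGL_of_sign :
    rsPlacesSection F E c hcc N T hJ hδ wOf₂ x₂ g = MpS.leviGL (GL.placeDiag (Fin N) _ (rsLeviFamily F E c hcc N T hJ hδ wOf₂ g)) := by
  rw [rsPlacesSection, placeLeviSection_apply]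
  refine MpS.conj_leviGL_eq_of_eq_diagonal_sign (fun jk => εR jk.2 jk.1) (fun jk => hεR jk.2 jk.1) _
    (coe_placeDiag_rsLeviFamily_of_sign E c N hcc p wOf₂ hJ hδ g εR hR) x₂ ?_
  rw [hx₂, proj_leviGL_placeDiag, ← map_mul, ← map_mul]
  congr 1
  funext k
  rw [Pi.mul_apply, Pi.mul_apply]
  have hk : ((rsLeviFamily F E c hcc N T hJ hδ wOf₂ g k : GL (Fin N) ℝ) : Matrix (Fin N) (Fin N) ℝ) = Matrix.diagonal (εR k) := by
    rw [coe_rsLeviFamily, hR k]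
  have hcomm := rsCayley_mul_proj_leviGL_of_eq_diagonal_sign (fun j => embedding_of_isReal k.1.2 (t₀ j))
    (embedding_t₀_ne_zero F N t₀ ht0 k.1) (embedding_of_isReal_ne_zero E (wOf₂ k) hδ) (εR k) (hεR k) _ hk
  -- `κ m = m κ ⇒ m κ⁻¹ = κ⁻¹ m`
  rw [rsCayley3]
  exact (Commute.inv_right (Commute.symm hcomm)).eq

/-! ## §3 The whole section: `archWeilSection3 x₂ x₃ g = leviGL ã` -/

/-! ### The projection of `reindex (1 ⊠ X₂) ⊠ 1`, coordinate by coordinate -/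

/-- first component at a real coordinate. [cite: Weil1964, Chap. I n° 12] -/
theorem coe_proj_three_fst_inl (X₂ : MpS (Fin N × {v : {v : InfinitePlace F // v.IsReal} // ¬ p v}))
    (pq : PV (FrameIdx F (Fin N))) (j : Fin N) (v : {v : InfinitePlace F // v.IsReal}) :
    (((MpS.proj (MpS.tensor (MpS.reindex (realBlockIdx N p)
        (MpS.tensor (1 : MpS (Fin N × {v : {v : InfinitePlace F // v.IsReal} // p v})) X₂))
        (1 : MpS ((Fin N ⊕ Fin N) × {v : InfinitePlace F // v.IsComplex})))).1 :
        (PV (FrameIdx F (Fin N))) ≃ₗ[ℝ] PV (FrameIdx F (Fin N))) pq).1 (Sum.inl (j, v)) =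
      (reindexPhase (realBlockIdx N p) (blockPhase id
        (⇑(((MpS.proj X₂) : SpR (Fin N × {v : {v : InfinitePlace F // v.IsReal} // ¬ p v})).1 : (PV _) ≃ₗ[ℝ] PV _)))
        (pq.1 ∘ Sum.inl, pq.2 ∘ Sum.inl)).1 (j, v) := rfl

/-- second component at a real coordinate. [cite: Weil1964, Chap. I n° 12] -/
theorem coe_proj_three_snd_inl (X₂ : MpS (Fin N × {v : {v : InfinitePlace F // v.IsReal} // ¬ p v}))
    (pq : PV (FrameIdx F (Fin N))) (j : Fin N) (v : {v : InfinitePlace F // v.IsReal}) :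
    (((MpS.proj (MpS.tensor (MpS.reindex (realBlockIdx N p)
        (MpS.tensor (1 : MpS (Fin N × {v : {v : InfinitePlace F // v.IsReal} // p v})) X₂))
        (1 : MpS ((Fin N ⊕ Fin N) × {v : InfinitePlace F // v.IsComplex})))).1 :
        (PV (FrameIdx F (Fin N))) ≃ₗ[ℝ] PV (FrameIdx F (Fin N))) pq).2 (Sum.inl (j, v)) =
      (reindexPhase (realBlockIdx N p) (blockPhase id
        (⇑(((MpS.proj X₂) : SpR (Fin N × {v : {v : InfinitePlace F // v.IsReal} // ¬ p v})).1 : (PV _) ≃ₗ[ℝ] PV _)))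
        (pq.1 ∘ Sum.inl, pq.2 ∘ Sum.inl)).2 (j, v) := rfl

/-- first component at a complex coordinate. [cite: Weil1964, Chap. I n° 12] -/
theorem coe_proj_three_fst_inr (X₂ : MpS (Fin N × {v : {v : InfinitePlace F // v.IsReal} // ¬ p v}))
    (pq : PV (FrameIdx F (Fin N))) (i : Fin N ⊕ Fin N) (v : {v : InfinitePlace F // v.IsComplex}) :
    (((MpS.proj (MpS.tensor (MpS.reindex (realBlockIdx N p)
        (MpS.tensor (1 : MpS (Fin N × {v : {v : InfinitePlace F // v.IsReal} // p v})) X₂))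
        (1 : MpS ((Fin N ⊕ Fin N) × {v : InfinitePlace F // v.IsComplex})))).1 :
        (PV (FrameIdx F (Fin N))) ≃ₗ[ℝ] PV (FrameIdx F (Fin N))) pq).1 (Sum.inr (i, v)) = pq.1 (Sum.inr (i, v)) := rfl

/-- second component at a complex coordinate. [cite: Weil1964, Chap. I n° 12] -/
theorem coe_proj_three_snd_inr (X₂ : MpS (Fin N × {v : {v : InfinitePlace F // v.IsReal} // ¬ p v}))
    (pq : PV (FrameIdx F (Fin N))) (i : Fin N ⊕ Fin N) (v : {v : InfinitePlace F // v.IsComplex}) :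
    (((MpS.proj (MpS.tensor (MpS.reindex (realBlockIdx N p)
        (MpS.tensor (1 : MpS (Fin N × {v : {v : InfinitePlace F // v.IsReal} // p v})) X₂))
        (1 : MpS ((Fin N ⊕ Fin N) × {v : InfinitePlace F // v.IsComplex})))).1 :
        (PV (FrameIdx F (Fin N))) ≃ₗ[ℝ] PV (FrameIdx F (Fin N))) pq).2 (Sum.inr (i, v)) = pq.2 (Sum.inr (i, v)) := rfl


include hεR in
omit [NumberField F] [NumberField E] [Algebra F E] in
/-- the sign pattern on the Folland frame (`ε_{v,j}` at the type-(ii) real coordinates, `1` elsewhere) takes the values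
`±1`. [cite: Folland1989, §4.2 (4.24)] -/
theorem sign3_cases (k : FrameIdx F (Fin N)) :
    Sum.elim (fun jv : Fin N × {v : InfinitePlace F // v.IsReal} => if h : p jv.2 then (1 : ℝ) else εR ⟨jv.2, h⟩ jv.1)
        (fun _ => (1 : ℝ)) k = 1 ∨
      Sum.elim (fun jv : Fin N × {v : InfinitePlace F // v.IsReal} => if h : p jv.2 then (1 : ℝ) else εR ⟨jv.2, h⟩ jv.1)
        (fun _ => (1 : ℝ)) k = -1 := by
  rcases k with ⟨j, v⟩ | ⟨i, v⟩
  · by_cases h : p v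
    · left; simp only [Sum.elim_inl, dif_pos h]
    · simp only [Sum.elim_inl, dif_neg h]; exact hεR ⟨v, h⟩ j
  · left; rfl

include hC hR hεR hx₂ in
/-- **THE THREE-BLOCK SECTION AT A SIGN ELEMENT IS THE SIGN LEVI OPERATOR**: `archWeilSection3 x₂ x₃ g = leviGL ã` for
every `ã ∈ GL(ℝ^{FrameIdx})` with matrix `diag(ε̃)`, `ε̃ = ε_{v,j}` at the type-(ii) coordinates and `1` elsewhere.
[cite: GelbartRogawski1991, §3.1 p. 455; Kudla1994, §3; Folland1989, §4.2 (4.23)–(4.24), (4.36)] -/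
theorem archWeilSection3_eq_leviGL_of_sign (ã : GL (FrameIdx F (Fin N)) ℝ)
    (hã : (ã : Matrix (FrameIdx F (Fin N)) (FrameIdx F (Fin N)) ℝ) = Matrix.diagonal
      (Sum.elim (fun jv : Fin N × {v : InfinitePlace F // v.IsReal} => if h : p jv.2 then (1 : ℝ) else εR ⟨jv.2, h⟩ jv.1)
        (fun _ => (1 : ℝ)))) :
    archWeilSection3 E c N hc hcc p wOf₁ hw₁ hover₁ wOf₂ wOf t₀ ht0 hTd hJ hcδ hδ x₂ x₃ g = MpS.leviGL ã := by
  have hA₂ := coe_placeDiag_rsLeviFamily_of_sign E c N hcc p wOf₂ hJ hδ g εR hR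
  have hε₂ : ∀ jk : Fin N × {v : {v : InfinitePlace F // v.IsReal} // ¬ p v}, εR jk.2 jk.1 = 1 ∨ εR jk.2 jk.1 = -1 :=
    fun jk => hεR jk.2 jk.1
  rw [archWeilSection3_apply, archWeilSectionSub_eq_one_of_sign E c N hc p wOf₁ hw₁ hover₁ t₀ ht0 hTd hJ hcδ hδ g hC,
    cxPlacesSection_eq_one_of_sign E c N hcc wOf hJ hδ x₃ g hC,
    rsPlacesSection_eq_leviGL_of_sign E c N hcc p wOf₂ t₀ ht0 hJ hδ x₂ hx₂ g εR hεR hR]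
  refine MpS.eq_of_proj_eq_of_vac_eq ?_ ?_ (MpS.vac_ne_zero _)
  · -- the projections agree: pointwise on `ℝ^{FrameIdx} × ℝ^{FrameIdx}`
    apply Subtype.ext
    apply LinearEquiv.ext
    intro pq
    refine Eq.trans ?_ (MpS.coe_proj_leviGL_apply_of_eq_diagonal_sign _ (sign3_cases N p εR hεR) ã hã pq).symm
    refine Prod.ext (funext fun k => ?_) (funext fun k => ?_)
    · rcases k with ⟨j, v⟩ | ⟨i, v⟩
      · rw [coe_proj_three_fst_inl]
        by_cases h : p v
        · rw [reindexPhase_realBlockIdx_fst_of_pos N p _ _ _ j h]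
          simp only [Matrix.mulVec_diagonal, Sum.elim_inl, dif_pos h, one_mul, id_eq, Function.comp_apply]
        · rw [reindexPhase_realBlockIdx_fst_of_neg N p _ _ _ j h, MpS.coe_proj_leviGL_apply_of_eq_diagonal_sign _ hε₂ _ hA₂]
          simp only [Matrix.mulVec_diagonal, Sum.elim_inl, dif_neg h, Function.comp_apply]
      · rw [coe_proj_three_fst_inr]
        simp only [Matrix.mulVec_diagonal, Sum.elim_inr, one_mul]
    · rcases k with ⟨j, v⟩ | ⟨i, v⟩
      · rw [coe_proj_three_snd_inl]
        by_cases h : p v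
        · rw [reindexPhase_realBlockIdx_snd_of_pos N p _ _ _ j h]
          simp only [Matrix.mulVec_diagonal, Sum.elim_inl, dif_pos h, one_mul, id_eq, Function.comp_apply]
        · rw [reindexPhase_realBlockIdx_snd_of_neg N p _ _ _ j h, MpS.coe_proj_leviGL_apply_of_eq_diagonal_sign _ hε₂ _ hA₂]
          simp only [Matrix.mulVec_diagonal, Sum.elim_inl, dif_neg h, Function.comp_apply]
      · rw [coe_proj_three_snd_inr]
        simp only [Matrix.mulVec_diagonal, Sum.elim_inr, one_mul]
  · -- the vacuum coefficients agree (both `1`)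
    have hv₂ : MpS.vac (MpS.leviGL (GL.placeDiag (Fin N) {v : {v : InfinitePlace F // v.IsReal} // ¬ p v}
        (rsLeviFamily F E c hcc N T hJ hδ wOf₂ g))) = 1 :=
      MpS.vac_eq_one_of_apply_hermitePi_zero (MpS.leviGL_apply_hermitePi_zero_of_eq_diagonal_sign _ hε₂ _ hA₂)
    have hv₃ : MpS.vac (MpS.leviGL ã) = 1 :=
      MpS.vac_eq_one_of_apply_hermitePi_zero (MpS.leviGL_apply_hermitePi_zero_of_eq_diagonal_sign _ (sign3_cases N p εR hεR) ã hã)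
    have h1a : MpS.vac (1 : MpS (Fin N × {v : {v : InfinitePlace F // v.IsReal} // p v})) = 1 := MpS.vac_one
    have h1c : MpS.vac (1 : MpS ((Fin N ⊕ Fin N) × {v : InfinitePlace F // v.IsComplex})) = 1 := MpS.vac_one
    rw [MpS.vac_tensor, MpS.vac_reindex, MpS.vac_tensor, h1a, h1c, hv₂, hv₃, one_mul, mul_one]

/-! ## §4 Consequences: origin value `+1`, and invariance under lifts of the centraliser -/

include hεR in
omit [NumberField E] [Algebra F E] in
/-- the sign diagonal of the frame is an involution. [cite: Folland1989, §4.2 (4.24)] -/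
theorem diagonal_sign3_mul_self :
    Matrix.diagonal (Sum.elim (fun jv : Fin N × {v : InfinitePlace F // v.IsReal} =>
        if h : p jv.2 then (1 : ℝ) else εR ⟨jv.2, h⟩ jv.1) (fun _ : (Fin N ⊕ Fin N) × {v : InfinitePlace F // v.IsComplex} => (1 : ℝ))) *
      Matrix.diagonal (Sum.elim (fun jv : Fin N × {v : InfinitePlace F // v.IsReal} =>
        if h : p jv.2 then (1 : ℝ) else εR ⟨jv.2, h⟩ jv.1) (fun _ => (1 : ℝ))) = 1 :=
  MpS.diagonal_sign_mul_self _ (sign3_cases N p εR hεR)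

include hεR in
omit [NumberField E] [Algebra F E] in
/-- a sign Levi element of `GL(ℝ^{FrameIdx})` with the frame sign pattern exists. [cite: Folland1989, §4.2 (4.24)] -/
theorem exists_signGL3 : ∃ ã : GL (FrameIdx F (Fin N)) ℝ, (ã : Matrix (FrameIdx F (Fin N)) (FrameIdx F (Fin N)) ℝ) =
    Matrix.diagonal (Sum.elim (fun jv : Fin N × {v : InfinitePlace F // v.IsReal} =>
      if h : p jv.2 then (1 : ℝ) else εR ⟨jv.2, h⟩ jv.1) (fun _ => (1 : ℝ))) :=
  ⟨⟨_, _, diagonal_sign3_mul_self N p εR hεR, diagonal_sign3_mul_self N p εR hεR⟩, rfl⟩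

include hC hR hεR hx₂ in
/-- **THE ORIGIN VALUE AT A SIGN ELEMENT IS `+1`**: `(archWeilSection3 x₂ x₃ g · f)(0) = f(0)` for every Schwartz `f`.
[cite: GelbartRogawski1991, §3.1 Prop. 3.1.1 p. 455; Kudla1994, §3 (3.5); Folland1989, §4.2 (4.24)] -/
theorem archWeilSection3_apply_zero_of_sign (f : SchwartzMap (FrameIdx F (Fin N) → ℝ) ℂ) :
    (archWeilSection3 E c N hc hcc p wOf₁ hw₁ hover₁ wOf₂ wOf t₀ ht0 hTd hJ hcδ hδ x₂ x₃ g).1.2 f 0 = f 0 := by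
  obtain ⟨ã, hã⟩ := exists_signGL3 N p εR hεR
  rw [archWeilSection3_eq_leviGL_of_sign E c N hc hcc p wOf₁ hw₁ hover₁ wOf₂ wOf t₀ ht0 hTd hJ hcδ hδ x₂ hx₂ x₃ g hC εR hεR hR
    ã hã]
  exact MpS.leviGL_apply_zero_of_eq_diagonal_sign _ (sign3_cases N p εR hεR) ã hã f

include hC hR hεR hx₂ in
/-- **INVARIANCE UNDER LIFTS OF THE CENTRALISER**: `z · archWeilSection3 x₂ x₃ g · z⁻¹ = archWeilSection3 x₂ x₃ g` for
every `z ∈ Mp^𝓢(ℝ^{FrameIdx})` whose projection commutes with that of the section at `g`.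
[cite: Folland1989, §4.2 (4.23)–(4.24), (4.36); GelbartRogawski1991, §3.1 p. 455] -/
theorem conj_archWeilSection3_of_sign (z : MpS (FrameIdx F (Fin N)))
    (hz : MpS.proj (archWeilSection3 E c N hc hcc p wOf₁ hw₁ hover₁ wOf₂ wOf t₀ ht0 hTd hJ hcδ hδ x₂ x₃ g) * MpS.proj z =
      MpS.proj z * MpS.proj (archWeilSection3 E c N hc hcc p wOf₁ hw₁ hover₁ wOf₂ wOf t₀ ht0 hTd hJ hcδ hδ x₂ x₃ g)) :
    z * archWeilSection3 E c N hc hcc p wOf₁ hw₁ hover₁ wOf₂ wOf t₀ ht0 hTd hJ hcδ hδ x₂ x₃ g * z⁻¹ =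
      archWeilSection3 E c N hc hcc p wOf₁ hw₁ hover₁ wOf₂ wOf t₀ ht0 hTd hJ hcδ hδ x₂ x₃ g := by
  obtain ⟨ã, hã⟩ := exists_signGL3 N p εR hεR
  have hS := archWeilSection3_eq_leviGL_of_sign E c N hc hcc p wOf₁ hw₁ hover₁ wOf₂ wOf t₀ ht0 hTd hJ hcδ hδ x₂ hx₂ x₃ g hC εR
    hεR hR ã hã
  rw [hS] at hz ⊢
  exact MpS.conj_leviGL_eq_of_eq_diagonal_sign _ (sign3_cases N p εR hεR) ã hã z hz

include hC hR hεR hx₂ in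
/-- the two consequences combined: `(z · archWeilSection3 x₂ x₃ g · z⁻¹ · f)(0) = f(0)` for such `z`.
[cite: GelbartRogawski1991, §3.1 Prop. 3.1.1 p. 455; Kudla1994, §3 (3.5)] -/
theorem conj_archWeilSection3_apply_zero_of_sign (z : MpS (FrameIdx F (Fin N)))
    (hz : MpS.proj (archWeilSection3 E c N hc hcc p wOf₁ hw₁ hover₁ wOf₂ wOf t₀ ht0 hTd hJ hcδ hδ x₂ x₃ g) * MpS.proj z =
      MpS.proj z * MpS.proj (archWeilSection3 E c N hc hcc p wOf₁ hw₁ hover₁ wOf₂ wOf t₀ ht0 hTd hJ hcδ hδ x₂ x₃ g))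
    (f : SchwartzMap (FrameIdx F (Fin N) → ℝ) ℂ) :
    (z * archWeilSection3 E c N hc hcc p wOf₁ hw₁ hover₁ wOf₂ wOf t₀ ht0 hTd hJ hcδ hδ x₂ x₃ g * z⁻¹).1.2 f 0 = f 0 := by
  rw [conj_archWeilSection3_of_sign E c N hc hcc p wOf₁ hw₁ hover₁ wOf₂ wOf t₀ ht0 hTd hJ hcδ hδ x₂ hx₂ x₃ g hC εR hεR hR z hz]
  exact archWeilSection3_apply_zero_of_sign E c N hc hcc p wOf₁ hw₁ hover₁ wOf₂ wOf t₀ ht0 hTd hJ hcδ hδ x₂ hx₂ x₃ g hC εR hεR hR f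

end Sign

end Literature.NumberTheory.Weil1964

end
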